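import Literature.Geometry.DiscreteGeometry.SphericalIsoperimetric
import Literature.MeasureTheory.Hausdorff.SphereArea
import HarnessLib

/-!
# The boundary of a finite union of balls in `ℝ³` through exposed directions, and the
# isoperimetric inequality for such unions in cube-free, `sphereFraction` form

Topic `Literature/Geometry/DiscreteGeometry` (sibling of `SphericalIsoperimetric.lean`, whose
normalised measure of a set of directions `sphereFraction A = vol(B(0,1) ∩ rayCone A)/vol B(0,1)`
(`= area(A)/4π`) and whose named fact `Federer1969_isoperimetricUnionBalls`
(`36π · vol(U)² ≤ area(∂U)³` for a finite union `U` of closed balls, `area = μHE[2]`) are used here).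
Written for the venture `Summits/Ventures/Crystal3D` (cell `pub-crystal3d`), whose surface-deficit
bound `C(n) ≤ 6n − γ n^{2/3}` takes as hypothesis an "isoperimetric input"
`Σᵢ exposedFraction ≥ s · N^{2/3}`; this file supplies the classical half of that input as a
PROVED corollary of the Federer fact, in the venture-free language of finitely many points of `ℝ³`.

## Content (everything PROVED; no new named fact)

* `euclideanHausdorff_eq_sphereFraction` — for a measurable `A ⊆ S²`,
  `μHE[2] A = 4π · sphereFraction A`: Mathlib's Euclidean Hausdorff measure of a set of directions
  IS its normalised cone measure.  From the tree's `κ = 1` theorem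
  `Literature.MeasureTheory.Hausdorff.comap_euclideanHausdorff_eq_toSphere`
  (`μHE[2]↾S² = volume.toSphere`) and Mathlib's `Measure.toSphere_apply'`
  (`toSphere s = 3 · vol((0,1) • s)`), via `ball 0 1 ∩ rayCone A = (0,1) • A`.
* `exposedDirections c r i` — for centres `c : ι → ℝ³` and a radius `r`: the unit vectors `u`
  such that `c i + r • u` lies in no OPEN ball `B(c j, r)`, `j ≠ i` (the directions in which the
  sphere `S(c i, r)` is exposed on the boundary of `⋃ⱼ B̄(c j, r)`); closed, hence measurable.
* `frontier_iUnion_closedBall_subset` — `∂ ⋃ᵢ B̄(cᵢ, r) ⊆ ⋃ᵢ (cᵢ + r • exposedDirections c r i)`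
  (`r > 0`), and `euclideanHausdorff_frontier_le` —
  `μHE[2] (∂ ⋃ᵢ B̄(cᵢ, r)) ≤ 4π r² · Σᵢ sphereFraction (exposedDirections c r i)`
  (subadditivity, translation invariance and `2`-homogeneity of `μHE[2]`).
* `volume_iUnion_closedBall_ge` — if the centres are pairwise `≥ 2ρ` apart and `0 < ρ ≤ r`, then
  `vol(⋃ᵢ B̄(cᵢ, r)) ≥ #ι · (4/3)πρ³` (the disjoint balls `B(cᵢ, ρ)` lie inside).
* `Federer1969_isoperimetricUnionBalls.sphereFraction_sum_cube` — the COROLLARY of the named fact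
  actually consumed downstream, with no cube roots:
  `36π · (#ι · (4/3)πρ³)² ≤ (4π r² · Σᵢ sphereFraction (exposedDirections c r i))³`.
  (For unit-diameter sphere packings probed at radius `r = 1`, `ρ = 1/2`, this is
  `Σᵢ sphereFraction ≥ N^{2/3}/4` after taking cube roots — done on the venture side.)

## Visibility

Only the corollary `Federer1969_isoperimetricUnionBalls.sphereFraction_sum_cube` (cited: it is the
printed inequality specialised and rearranged) and the plumbing definition `exposedDirections` are
public; the intermediate lemmas are `private` helpers (standard facts for which this file claims no
printed locator — `Literature/` exports only cited statements).

## What is NOT here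

No proof of the Federer fact itself (it stays a cited named fact, `SphericalIsoperimetric.lean`);
nothing about packings, contact numbers or the venture's `exposedCap`/`IsoInput` vocabulary (the
one-line identification `exposedCap x r i = exposedDirections x r i` is the consumer's business);
no general dimension (`-- TODO(general form)`: `ℝⁿ`, `μHE[n-1]`, `n · vol(B)`).

## References

* H. Federer, *Geometric Measure Theory*, Springer 1969, §3.2.43, §3.2.39. [`Federer1969`]
* T. Figiel, J. Lindenstrauss, V. D. Milman, Acta Math. 139 (1977), §2 (the normalised measure
  `μ₂` on `S²`). [`FigielLindenstraussMilman1977`]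
-/

noncomputable section

namespace Literature.Geometry.DiscreteGeometry

open Real Metric Set
open _root_.MeasureTheory _root_.MeasureTheory.Measure
open scoped ENNReal NNReal Pointwise

local notation "E3" => EuclideanSpace ℝ (Fin 3)

/-! ### `μHE[2]` of a set of directions is `4π · sphereFraction` -/

/-- For a set of unit vectors `A`, the part of the open unit ball over `A` is the pointwise
product `(0,1) • A`: `B(0,1) ∩ rayCone A = Ioo 0 1 • A`. [folklore] -/
private theorem ball_inter_rayCone_eq_smul {A : Set E3} (hA : A ⊆ sphere (0 : E3) 1) :
    ball (0 : E3) 1 ∩ rayCone A = Set.Ioo (0 : ℝ) 1 • A := by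
  ext x
  constructor
  · rintro ⟨hx1, hx0, hxA⟩
    rw [mem_ball_zero_iff] at hx1
    refine Set.mem_smul.2 ⟨‖x‖, ⟨norm_pos_iff.2 hx0, hx1⟩, ‖x‖⁻¹ • x, hxA, ?_⟩
    rw [smul_smul, mul_inv_cancel₀ (norm_ne_zero_iff.2 hx0), one_smul]
  · intro hx
    obtain ⟨t, ht, a, haA, rfl⟩ := Set.mem_smul.1 hx
    have ha : ‖a‖ = 1 := mem_sphere_zero_iff_norm.1 (hA haA)
    have hn : ‖t • a‖ = t := by
      rw [norm_smul, ha, mul_one, Real.norm_of_nonneg ht.1.le]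
    refine ⟨?_, ?_, ?_⟩
    · rw [mem_ball_zero_iff, hn]
      exact ht.2
    · rw [← norm_ne_zero_iff, hn]
      exact ht.1.ne'
    · show ‖t • a‖⁻¹ • (t • a) ∈ A
      rw [hn, smul_smul, inv_mul_cancel₀ ht.1.ne', one_smul]
      exact haA

/-- The volume of the unit ball of `ℝ³` as a real number: `4π/3`. [folklore] -/
private theorem volume_unitBall_toReal : (volume (ball (0 : E3) (1 : ℝ))).toReal = π * 4 / 3 := by
  rw [EuclideanSpace.volume_ball_fin_three, ENNReal.ofReal_one, one_pow, one_mul,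
    ENNReal.toReal_ofReal (by positivity)]

/-- **`μHE[2]` on the sphere is the normalised cone measure**: for a measurable set of unit vectors
`A ⊆ S² ⊂ ℝ³`, `μHE[2] A = 4π · sphereFraction A`.  (Mathlib's Euclidean `2`-dimensional Hausdorff
measure; `sphereFraction` = Figiel–Lindenstrauss–Milman's `μ₂`; the identification is the tree's
`κ = 1` theorem `comap_euclideanHausdorff_eq_toSphere` plus `toSphere s = 3 · vol((0,1) • s)`.)
[folklore] -/
private theorem euclideanHausdorff_eq_sphereFraction {A : Set E3} (hA : A ⊆ sphere (0 : E3) 1)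
    (hm : MeasurableSet A) :
    (μHE[2] : Measure E3) A = ENNReal.ofReal (4 * π * sphereFraction A) := by
  have hE : Module.finrank ℝ E3 = 3 := finrank_euclideanSpace_fin
  set s : Set (sphere (0 : E3) 1) := Subtype.val ⁻¹' A with hs
  have hsm : MeasurableSet s := measurable_subtype_coe hm
  have himg : (Subtype.val '' s) = A := by
    rw [hs, Subtype.image_preimage_coe, Set.inter_eq_right.2 hA]
  have hme := MeasurableEmbedding.subtype_coe
    ((isClosed_sphere : IsClosed (sphere (0 : E3) 1)).measurableSet)
  have h1 : (μHE[2] : Measure E3) A = ((μHE[2] : Measure E3).comap Subtype.val) s := by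
    rw [hme.comap_apply, himg]
  rw [h1, Literature.MeasureTheory.Hausdorff.comap_euclideanHausdorff_eq_toSphere hE,
    Measure.toSphere_apply' _ hsm, himg, hE, ← ball_inter_rayCone_eq_smul hA]
  have hfin : volume (ball (0 : E3) 1 ∩ rayCone A) ≠ ⊤ :=
    (lt_of_le_of_lt (measure_mono inter_subset_left) measure_ball_lt_top).ne
  have hV : volume (ball (0 : E3) 1 ∩ rayCone A) =
      ENNReal.ofReal (sphereFraction A * (π * 4 / 3)) := by
    rw [← ENNReal.ofReal_toReal hfin]
    congr 1
    rw [sphereFraction_eq, volume_unitBall_toReal, div_mul_cancel₀ _ (by positivity)]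
  rw [hV, Nat.cast_ofNat, show (3 : ℝ≥0∞) = ENNReal.ofReal 3 by norm_num,
    ← ENNReal.ofReal_mul (by norm_num)]
  congr 1
  ring

/-! ### Exposed directions of a finite family of balls -/

section Balls

variable {ι : Type*}

/-- The **exposed directions** of the `i`-th ball at radius `r`: unit vectors `u` such that the
boundary point `c i + r • u` of `B̄(c i, r)` lies in no open ball `B(c j, r)` with `j ≠ i`, i.e. is not
swallowed by another ball of the union `⋃ⱼ B̄(c j, r)`.  (Same shape as the venture's `exposedCap`,
stated for bare points so that this file imports nothing problem-side.) [folklore] -/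
def exposedDirections (c : ι → E3) (r : ℝ) (i : ι) : Set E3 :=
  {u | ‖u‖ = 1 ∧ ∀ j, j ≠ i → r ≤ dist (c i + r • u) (c j)}

/-- Exposed directions are unit vectors. [folklore] -/
private theorem exposedDirections_subset_sphere (c : ι → E3) (r : ℝ) (i : ι) :
    exposedDirections c r i ⊆ sphere (0 : E3) 1 :=
  fun _ hu => mem_sphere_zero_iff_norm.2 hu.1

/-- The set of exposed directions is closed (an intersection of closed conditions). [folklore] -/
private theorem isClosed_exposedDirections (c : ι → E3) (r : ℝ) (i : ι) :
    IsClosed (exposedDirections c r i) := by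
  have h1 : IsClosed {u : E3 | ‖u‖ = 1} := isClosed_eq continuous_norm continuous_const
  have h2 : IsClosed {u : E3 | ∀ j, j ≠ i → r ≤ dist (c i + r • u) (c j)} := by
    rw [Set.setOf_forall]
    refine isClosed_iInter fun j => ?_
    by_cases hj : j = i
    · have he : {u : E3 | j ≠ i → r ≤ dist (c i + r • u) (c j)} = univ :=
        Set.eq_univ_of_forall fun u hne => absurd hj hne
      rw [he]
      exact isClosed_univ
    · have he : {u : E3 | j ≠ i → r ≤ dist (c i + r • u) (c j)} =
          {u : E3 | r ≤ dist (c i + r • u) (c j)} :=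
        Set.ext fun u => ⟨fun hu => hu hj, fun hu _ => hu⟩
      rw [he]
      exact isClosed_le continuous_const (by fun_prop)
  exact h1.inter h2

/-- The set of exposed directions is measurable. [folklore] -/
private theorem measurableSet_exposedDirections (c : ι → E3) (r : ℝ) (i : ι) :
    MeasurableSet (exposedDirections c r i) :=
  (isClosed_exposedDirections c r i).measurableSet

variable [Fintype ι]

/-- **The boundary of a finite union of closed balls of radius `r > 0` consists of exposed
points**: `∂ ⋃ᵢ B̄(cᵢ, r) ⊆ ⋃ᵢ {cᵢ + r • u | u ∈ exposedDirections c r i}`.  (A boundary point lies in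
the closed union but in no open ball `B(cⱼ, r)`, since those are interior.) [folklore] -/
private theorem frontier_iUnion_closedBall_subset (c : ι → E3) {r : ℝ} (hr : 0 < r) :
    frontier (⋃ i, closedBall (c i) r) ⊆
      ⋃ i, (fun u : E3 => c i + r • u) '' exposedDirections c r i := by
  intro p hp
  have hU : IsClosed (⋃ i, closedBall (c i) r) :=
    isClosed_iUnion_of_finite fun i => isClosed_closedBall
  have hpU : p ∈ ⋃ i, closedBall (c i) r := hU.frontier_subset hp
  have hfar : ∀ j, r ≤ dist p (c j) := by
    intro j
    by_contra h
    rw [not_le] at h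
    have hint : p ∈ interior (⋃ i, closedBall (c i) r) := by
      refine interior_mono (subset_iUnion (fun i => closedBall (c i) r) j) ?_
      rw [interior_closedBall _ hr.ne']
      exact mem_ball.2 h
    exact hp.2 hint
  obtain ⟨i, hi⟩ := mem_iUnion.1 hpU
  have hdist : dist p (c i) = r := le_antisymm (mem_closedBall.1 hi) (hfar i)
  have hp_eq : c i + r • (r⁻¹ • (p - c i)) = p := by
    rw [smul_smul, mul_inv_cancel₀ hr.ne', one_smul, add_sub_cancel]
  refine mem_iUnion.2 ⟨i, r⁻¹ • (p - c i), ⟨?_, fun j _ => ?_⟩, hp_eq⟩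
  · rw [norm_smul, norm_inv, Real.norm_of_nonneg hr.le, ← dist_eq_norm, hdist,
      inv_mul_cancel₀ hr.ne']
  · rw [hp_eq]
    exact hfar j

omit [Fintype ι] in
/-- The area of the translated and scaled set of exposed directions:
`μHE[2] (cᵢ + r • exposedDirections c r i) = 4π r² · sphereFraction (exposedDirections c r i)`
(`r > 0`; translation invariance and `2`-homogeneity of `μHE[2]`). [folklore] -/
private theorem euclideanHausdorff_image_exposedDirections (c : ι → E3) {r : ℝ} (hr : 0 < r) (i : ι) :
    (μHE[2] : Measure E3) ((fun u : E3 => c i + r • u) '' exposedDirections c r i) =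
      ENNReal.ofReal (4 * π * r ^ 2 * sphereFraction (exposedDirections c r i)) := by
  have himg : (fun u : E3 => c i + r • u) '' exposedDirections c r i =
      (fun u : E3 => c i + u) '' (r • exposedDirections c r i) := by
    rw [← image_smul, image_image]
  have hiso : Isometry (fun u : E3 => c i + u) := fun x y => edist_add_left (c i) x y
  rw [himg, hiso.euclideanHausdorffMeasure_image,
    Measure.euclideanHausdorffMeasure_smul₀ 2 hr.ne',
    euclideanHausdorff_eq_sphereFraction (exposedDirections_subset_sphere c r i)
      (measurableSet_exposedDirections c r i),
    ENNReal.smul_def, smul_eq_mul, ENNReal.coe_pow, ← ENNReal.ofReal_coe_nnreal, coe_nnnorm,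
    Real.norm_eq_abs, abs_of_pos hr, ← ENNReal.ofReal_pow hr.le,
    ← ENNReal.ofReal_mul (by positivity)]
  congr 1
  ring

/-- **Area of the boundary of a finite union of balls through exposed directions**:
`μHE[2] (∂ ⋃ᵢ B̄(cᵢ, r)) ≤ 4π r² · Σᵢ sphereFraction (exposedDirections c r i)` (`r > 0`).
[folklore] -/
private theorem euclideanHausdorff_frontier_le (c : ι → E3) {r : ℝ} (hr : 0 < r) :
    (μHE[2] : Measure E3) (frontier (⋃ i, closedBall (c i) r)) ≤
      ENNReal.ofReal (4 * π * r ^ 2 * ∑ i, sphereFraction (exposedDirections c r i)) := by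
  have hnn : ∀ i, 0 ≤ 4 * π * r ^ 2 * sphereFraction (exposedDirections c r i) :=
    fun i => mul_nonneg (by positivity) (sphereFraction_nonneg _)
  calc (μHE[2] : Measure E3) (frontier (⋃ i, closedBall (c i) r))
      ≤ (μHE[2] : Measure E3) (⋃ i, (fun u : E3 => c i + r • u) '' exposedDirections c r i) :=
        measure_mono (frontier_iUnion_closedBall_subset c hr)
    _ ≤ ∑ i, (μHE[2] : Measure E3) ((fun u : E3 => c i + r • u) '' exposedDirections c r i) :=
        measure_iUnion_fintype_le _ _
    _ = ∑ i, ENNReal.ofReal (4 * π * r ^ 2 * sphereFraction (exposedDirections c r i)) := by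
        simp_rw [euclideanHausdorff_image_exposedDirections c hr]
    _ = ENNReal.ofReal (∑ i, 4 * π * r ^ 2 * sphereFraction (exposedDirections c r i)) :=
        (ENNReal.ofReal_sum_of_nonneg fun i _ => hnn i).symm
    _ = ENNReal.ofReal (4 * π * r ^ 2 * ∑ i, sphereFraction (exposedDirections c r i)) := by
        rw [Finset.mul_sum]

/-- **Volume of a union of balls with separated centres**: if the centres are pairwise at distance
`≥ 2ρ` and `0 < ρ ≤ r`, the disjoint balls `B(cᵢ, ρ)` lie in `⋃ᵢ B̄(cᵢ, r)`, so
`vol(⋃ᵢ B̄(cᵢ, r)) ≥ #ι · (4/3)πρ³`. [folklore] -/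
private theorem volume_iUnion_closedBall_ge (c : ι → E3) {r ρ : ℝ} (hρ : 0 < ρ) (hρr : ρ ≤ r)
    (hsep : Pairwise fun i j => 2 * ρ ≤ dist (c i) (c j)) :
    ENNReal.ofReal (Fintype.card ι * (4 / 3 * π * ρ ^ 3)) ≤ volume (⋃ i, closedBall (c i) r) := by
  have hdisj : Pairwise (Function.onFun Disjoint fun i => ball (c i) ρ) := by
    intro i j hij
    apply ball_disjoint_ball
    linarith [hsep hij]
  calc ENNReal.ofReal (Fintype.card ι * (4 / 3 * π * ρ ^ 3))
      = ∑ i : ι, volume (ball (c i) ρ) := by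
        rw [Finset.sum_congr rfl fun i _ => EuclideanSpace.volume_ball_fin_three (c i) ρ,
          Finset.sum_const, Finset.card_univ, nsmul_eq_mul, ← ENNReal.ofReal_pow hρ.le,
          ← ENNReal.ofReal_mul (by positivity), ← ENNReal.ofReal_natCast,
          ← ENNReal.ofReal_mul (by positivity)]
        congr 1
        ring
    _ = volume (⋃ i, ball (c i) ρ) := by
        rw [measure_iUnion hdisj fun i => measurableSet_ball, tsum_fintype]
    _ ≤ volume (⋃ i, closedBall (c i) r) :=
        measure_mono (iUnion_mono fun i =>
          ball_subset_closedBall.trans (closedBall_subset_closedBall hρr))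

end Balls

/-! ### The isoperimetric inequality for separated unions of balls, cube-free -/

/-- **Corollary of Federer's isoperimetric inequality for finite unions of balls** (the form the
surface-deficit chain consumes, no cube roots): if the centres `cᵢ` are pairwise `≥ 2ρ` apart and
`0 < ρ ≤ r`, then with `σᵢ = sphereFraction (exposedDirections c r i)`,
`36π · (#ι · (4/3)πρ³)² ≤ (4π r² · Σᵢ σᵢ)³`
— i.e. `36π vol(U)² ≤ area(∂U)³` for `U = ⋃ᵢ B̄(cᵢ, r)` [Federer 3.2.43 + 3.2.39, the named fact
`Federer1969_isoperimetricUnionBalls`, taken as the hypothesis `h`], combined with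
`vol(U) ≥ #ι · (4/3)πρ³` (`volume_iUnion_closedBall_ge`) and `area(∂U) ≤ 4π r² Σᵢ σᵢ`
(`euclideanHausdorff_frontier_le`).  For unit-diameter packings probed at `r = 1` (`ρ = 1/2`) this
reads `Σᵢ σᵢ ≥ N^{2/3}/4` after cube roots. [cite: Federer1969, §3.2.43 and §3.2.39] -/
theorem Federer1969_isoperimetricUnionBalls.sphereFraction_sum_cube
    (h : Federer1969_isoperimetricUnionBalls) {ι : Type} [Fintype ι] (c : ι → E3) {r ρ : ℝ}
    (hρ : 0 < ρ) (hρr : ρ ≤ r) (hsep : Pairwise fun i j => 2 * ρ ≤ dist (c i) (c j)) :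
    36 * π * (Fintype.card ι * (4 / 3 * π * ρ ^ 3)) ^ 2 ≤
      (4 * π * r ^ 2 * ∑ i, sphereFraction (exposedDirections c r i)) ^ 3 := by
  have hr : 0 < r := hρ.trans_le hρr
  have hiso : 36 * π * ((volume (⋃ i, closedBall (c i) r)).toReal) ^ 2 ≤
      (((μHE[2] : Measure E3) (frontier (⋃ i, closedBall (c i) r))).toReal) ^ 3 := by
    simpa using (h ι c (fun _ => r)).2
  have hUfin : volume (⋃ i, closedBall (c i) r) ≠ ⊤ :=
    (isCompact_iUnion fun i => isCompact_closedBall (c i) r).measure_lt_top.ne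
  have hvol : Fintype.card ι * (4 / 3 * π * ρ ^ 3) ≤ (volume (⋃ i, closedBall (c i) r)).toReal :=
    (ENNReal.ofReal_le_iff_le_toReal hUfin).1 (volume_iUnion_closedBall_ge c hρ hρr hsep)
  have hsum : 0 ≤ 4 * π * r ^ 2 * ∑ i, sphereFraction (exposedDirections c r i) :=
    mul_nonneg (by positivity) (Finset.sum_nonneg fun i _ => sphereFraction_nonneg _)
  have harea : ((μHE[2] : Measure E3) (frontier (⋃ i, closedBall (c i) r))).toReal ≤
      4 * π * r ^ 2 * ∑ i, sphereFraction (exposedDirections c r i) :=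
    ENNReal.toReal_le_of_le_ofReal hsum (euclideanHausdorff_frontier_le c hr)
  have hv0 : 0 ≤ (Fintype.card ι : ℝ) * (4 / 3 * π * ρ ^ 3) := by positivity
  calc 36 * π * (Fintype.card ι * (4 / 3 * π * ρ ^ 3)) ^ 2
      ≤ 36 * π * ((volume (⋃ i, closedBall (c i) r)).toReal) ^ 2 := by gcongr
    _ ≤ (((μHE[2] : Measure E3) (frontier (⋃ i, closedBall (c i) r))).toReal) ^ 3 := hiso
    _ ≤ (4 * π * r ^ 2 * ∑ i, sphereFraction (exposedDirections c r i)) ^ 3 := by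
        gcongr

/-- **The same corollary with the volume bound decoupled from the centres** (the form used when
the lower bound on `vol(U)` comes from elsewhere, e.g. from a Voronoi-cell volume bound): if
`0 ≤ v` and `v ≤ vol(⋃ᵢ B̄(cᵢ, r))` (`r > 0`), then `36π · v² ≤ (4π r² · Σᵢ σᵢ)³` with
`σᵢ = sphereFraction (exposedDirections c r i)` — Federer's `36π vol(U)² ≤ area(∂U)³`
[the named fact, hypothesis `h`] combined with `area(∂U) ≤ 4π r² Σᵢ σᵢ`.
[cite: Federer1969, §3.2.43 and §3.2.39] -/
theorem Federer1969_isoperimetricUnionBalls.sphereFraction_sum_cube_of_le_volume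
    (h : Federer1969_isoperimetricUnionBalls) {ι : Type} [Fintype ι] (c : ι → E3) {r : ℝ}
    (hr : 0 < r) {v : ℝ} (hv0 : 0 ≤ v) (hv : ENNReal.ofReal v ≤ volume (⋃ i, closedBall (c i) r)) :
    36 * π * v ^ 2 ≤ (4 * π * r ^ 2 * ∑ i, sphereFraction (exposedDirections c r i)) ^ 3 := by
  have hiso : 36 * π * ((volume (⋃ i, closedBall (c i) r)).toReal) ^ 2 ≤
      (((μHE[2] : Measure E3) (frontier (⋃ i, closedBall (c i) r))).toReal) ^ 3 := by
    simpa using (h ι c (fun _ => r)).2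
  have hUfin : volume (⋃ i, closedBall (c i) r) ≠ ⊤ :=
    (isCompact_iUnion fun i => isCompact_closedBall (c i) r).measure_lt_top.ne
  have hvol : v ≤ (volume (⋃ i, closedBall (c i) r)).toReal :=
    (ENNReal.ofReal_le_iff_le_toReal hUfin).1 hv
  have hsum : 0 ≤ 4 * π * r ^ 2 * ∑ i, sphereFraction (exposedDirections c r i) :=
    mul_nonneg (by positivity) (Finset.sum_nonneg fun i _ => sphereFraction_nonneg _)
  have harea : ((μHE[2] : Measure E3) (frontier (⋃ i, closedBall (c i) r))).toReal ≤
      4 * π * r ^ 2 * ∑ i, sphereFraction (exposedDirections c r i) :=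
    ENNReal.toReal_le_of_le_ofReal hsum (euclideanHausdorff_frontier_le c hr)
  calc 36 * π * v ^ 2
      ≤ 36 * π * ((volume (⋃ i, closedBall (c i) r)).toReal) ^ 2 := by gcongr
    _ ≤ (((μHE[2] : Measure E3) (frontier (⋃ i, closedBall (c i) r))).toReal) ^ 3 := hiso
    _ ≤ (4 * π * r ^ 2 * ∑ i, sphereFraction (exposedDirections c r i)) ^ 3 := by
        gcongr

end Literature.Geometry.DiscreteGeometry

end
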